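import Literature.AlgebraicGeometry.HodgeTheory.MotivatedClasses
import HarnessLib

/-!
# The Lefschetz standard conjecture `B(X)` IN ONE DEGREE, in André's `*_L`-form on the real carriers — DEFINITION + kernel

Topic `Literature/AlgebraicGeometry/HodgeTheory`; one definition (`LefschetzStandardInDegree`) and its
unfolding lemmas, no named fact (net debt 0).  Written by the literature seat `hodge-lit-oqh-2` (LT-H4
open-question harvest, ladder HodgeAV rungs H2/H3) because the tree's `StandardConjectureBStar n X η`
(file `MotivatedClasses`) renders Grothendieck's `B(X)` only ALL DEGREES AT ONCE, while several printed
theorems and hypotheses that the Hodge seats cite are stated DEGREE BY DEGREE: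

* J. Foster, *The Lefschetz standard conjectures for IHSMs of generalized Kummer deformation type in certain
  degrees*, Eur. J. Math. 10 (2024) [`Foster2024`], Thm. 1: `B(Y)` for projective `Kumⁿ`-type `Y` "in degrees
  `< 2(n+1)(j-1)/j`", `j` the least prime factor of `n + 1`; Cor. 71: "in degrees 2 and 3" for every `n`
  (the record `Hyperkaehler.Foster2024_lefschetzStandard_kummerType_prime` could only render the case
  `n + 1` prime, where all degrees are covered — its module docstring: "Theorem 1 in composite `n + 1` … would
  need a degree-wise `*_L` predicate");
* M. Varesco, Math. Z. 305 (2023) Cor. 4.6: "if moreover `X` satisfies the Lefschetz standard conjecture in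
  degree 2" (recorded with the full `B(X)` as hypothesis in
  `Hyperkaehler.Varesco2023_transcendentalHodgeSimilitude_algebraic_of_lefschetzStandard`, hence WEAKER than
  print);
* F. Charles–E. Markman, Compos. Math. 149 (2013) §2 ("`X` satisfies the Lefschetz standard conjecture in
  degrees up to `i`"), de Jong–Perry (period–index from `B` in degree 2), Voisin's survey below.

## Sources (read at source)

* C. Voisin, *Hodge and generalized Hodge conjectures, coniveau and algebraic cycles*, J. Open Math. Probl. 1
  (2025) 16–51 [`Voisin2025`], §3.2.2 p. 29 (held text `paper:voisin2025-…` p0016:L2–L12), verbatim: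
  "we get inverse isomorphisms `γ_k := (l^{n-k})^{-1} : H^{2n-k}(X, ℚ) → H^k(X, ℚ)` (15) for `k ≤ n = dim X`.
  Note that `γ_k` is a morphism of Hodge structures, hence provides by Lemma 2.9 a Hodge class of degree `2k`
  on `X × X`. The Lefschetz standard conjecture for degree `k` cohomology is the following statement.
  **Conjecture 3.11.** For each `k ≤ n`, there exists a codimension `k` cycle `Z` in `X × X`, such that the
  class `[Z] ∈ Hdg^{2k}(X × X)` satisfies `[Z]^* = (l^{n-k})^{-1} : H^{2n-k}(X, ℚ) → H^k(X, ℚ)`. (16)"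
* J. Foster 2024, §1.1 (arXiv:2303.14327 p. 2 L14–L22), verbatim: "For each `k ≤ n`, there exists an algebraic
  self-correspondence `[𝒵] ∈ H^{2k}(X × X, ℚ)`, arising from a codimension-`k` cycle `𝒵 ∈ CH^k(X × X)`, such
  that the isomorphism `[𝒵]^* : H^{2n-k}(X, ℚ) → H^k(X, ℚ)` is the inverse of the isomorphism `L^{n-k}`. If the
  correspondence `[𝒵]` exists for a particular `k ≤ n`, the Lefschetz standard conjecture `B(X)` is said to
  hold for `X` in degree `k`, and […] is said to hold for `X` if it holds in all degrees. […] We note also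
  that the statement of the LSC is independent of the choice of polarization on `X` ([K1])."
* Y. André, Publ. Math. IHÉS 83 (1996) [`Andre1996Motifs`] §0.2, §1.1: `*_L` "donnée en chaque degré par
  l'isomorphisme de Lefschetz ou son inverse" — the tree's `lefschetzInvolution`.

## Rendering and faithfulness

For `X` smooth projective of dimension `n` over `ℂ`, `η ∈ H²(X(ℂ); ℂ)` and a degree `k`,
`LefschetzStandardInDegree n X η k` says: for every polarisation-class witness `hη` (the predicate is
vacuous for other `η`, exactly as `StandardConjectureBStar`) and every complementary degree `a` with
`a + k = 2n`, André's `*_L : Hᵃ(X(ℂ); ℂ) → Hᵏ(X(ℂ); ℂ)` (`lefschetzInvolution hη.hasHardLefschetz`) is induced by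
an algebraic class on `X × X` (`IsAlgebraicCorrespondence n n X X`).  It is LITERALLY the degree-`(·, k)`
instance of the body of `StandardConjectureBStar` (`bStar_iff_forall_lefschetzStandardInDegree` below is
`Iff.rfl` up to currying), so every convention of that predicate is inherited unchanged: coefficients `ℂ`
with algebraic = `ℂ`-span of cycle classes, orientations, polarisation classes a priori wider than
"`c₁` of an ample sheaf" with independence of the polarisation by Kleiman 1968 / André §3.2 (module docstring of
`LefschetzStandardConjectureFacts`, Faithfulness 1).
* For `k ≤ n` (the only case in which Voisin, Foster and Charles–Markman DEFINE "degree `k`"): `a = 2n - k ≥ n`,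
  and `*_L` on `Hᵃ` is the inverse of the hard-Lefschetz isomorphism `L^{n-k} : Hᵏ → H^{2n-k}`
  (`lefschetzInvolution_lefschetzPow`), i.e. Voisin's `γ_k` / Foster's `[𝒵]^*` — FAITHFUL.
* For `k > n` the predicate is still meaningful and says that `*_L = L^{k-n} : H^{2n-k} → Hᵏ`
  (`lefschetzInvolution_apply_of_le`) is induced by an algebraic class — true in print unconditionally
  (`L` is cup product with an algebraic class; the standing reading "the degree-`a ≤ n` half of `*_L` is
  algebraic outright" of `MotivatedClasses` / `LefschetzStandardConjectureFacts`), so nothing stronger than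
  print is asserted by any instance, and `B(X) ⟺ ∀ k, B(X) in degree k` holds on the nose
  (`bStar_iff_forall_lefschetzStandardInDegree`).  We do NOT restrict to `k ≤ n` precisely so that this
  equivalence is definitional; a consumer who wants the printed range simply takes `k ≤ n`.
* A per-`(X, η, k)` PREDICATE; nothing is asserted here for any `X` (Grothendieck's question is whether
  every `X` has it in every degree; for general `X` and `0 < k < n` no proof is in print beyond the classical
  list — curves, surfaces, abelian varieties, flag varieties, …).  Printed THEOREMS in single degrees (Foster
  2024 for `Kumⁿ`-type; Voisin 2022 / Ancona et al. for Lagrangian fibrations in degree 2) are recorded in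
  their own files on this predicate.

## Not here

The "degrees up to `i`" bookkeeping of Charles–Markman §2 / Foster §5 (it is `∀ k ≤ i, … k`); the
relation with Grothendieck's `A(X)` in one degree; any motive-level statement (Künneth projectors).
-/

noncomputable section

open CategoryTheory MonoidalCategory

namespace Literature.AlgebraicGeometry.HodgeTheory

variable {n : ℕ} {X : Motives.SchemeOver ℂ} {η : complexBetti X 2}

variable (n X η) in
/-- **The property "`B(X)` holds in degree `k`"**, André's `*_L`-form on the real carriers — a PREDICATE on
`(X, η, k)` (the degree-`k` slice of the tree's all-degrees `*_L`-algebraicity predicate of file `MotivatedClasses` (André's form of `B(X)`); nothing is asserted for any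
`X` in this file): for `X` smooth projective of dimension `n` over `ℂ`, a polarisation class `η` (vacuous
otherwise) and every `a` with `a + k = 2n`, the Lefschetz involution `*_L : Hᵃ(X(ℂ); ℂ) → Hᵏ(X(ℂ); ℂ)` is
induced by an algebraic class on `X × X`.  For `k ≤ n` this is Grothendieck's `B(X)` in degree `k` as
DEFINED by Voisin 2025 §3.2.2 (3.11) ("there exists a codimension `k` cycle `Z` in `X × X`, such that the
class `[Z] ∈ Hdg^{2k}(X × X)` satisfies `[Z]^* = (l^{n-k})^{-1} : H^{2n-k}(X, ℚ) → H^k(X, ℚ)`") and by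
Foster 2024 §1.1 ("`B(X)` is said to hold for `X` in degree `k`"); for `k > n` it is the print-trivial
algebraicity of `L^{k-n}` (module docstring), so that
the all-degrees predicate is equivalent to `∀ k, LefschetzStandardInDegree n X η k`
definitionally (`bStar_iff_forall_lefschetzStandardInDegree`).  Printed theorems establishing the property for particular
`X` and `k` are recorded on this predicate in their own files. [cite: Voisin2025, §3.2.2 (3.11) with (15)–(16) (p. 29)]
[cite: Foster2024, §1.1 (arXiv:2303.14327 p. 2)] [cite: Andre1996Motifs, §0.2 (p. 7) and §1.1 (p. 10)] -/
def LefschetzStandardInDegree (k : ℕ) : Prop :=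
  ∀ (hη : IsPolarizationClass n X η) ⦃a : ℕ⦄ (hak : a + k = 2 * n),
    IsAlgebraicCorrespondence n n X X (lefschetzInvolution hη.hasHardLefschetz hak)

/-- Unfolding lemma. [cite: Voisin2025, §3.2.2 (3.11) (p. 29)] -/
theorem lefschetzStandardInDegree_iff (k : ℕ) :
    LefschetzStandardInDegree n X η k ↔
      ∀ (hη : IsPolarizationClass n X η) ⦃a : ℕ⦄ (hak : a + k = 2 * n),
        IsAlgebraicCorrespondence n n X X (lefschetzInvolution hη.hasHardLefschetz hak) :=
  Iff.rfl

/-- `B(X)` (all degrees at once, `StandardConjectureBStar`) implies `B(X)` in every degree `k`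
("`B(X)` is said to hold for `X` if it holds in all degrees"). [cite: Foster2024, §1.1 (arXiv:2303.14327 p. 2)] -/
theorem lefschetzStandardInDegree_of_bStar (h : StandardConjectureBStar n X η) (k : ℕ) :
    LefschetzStandardInDegree n X η k :=
  fun hη _ hak => h hη _ _ hak

/-- `B(X)` in every degree `k` gives `B(X)` (all degrees). [cite: Foster2024, §1.1 (arXiv:2303.14327 p. 2)] -/
theorem bStar_of_forall_lefschetzStandardInDegree (h : ∀ k, LefschetzStandardInDegree n X η k) :
    StandardConjectureBStar n X η :=
  fun hη _ b hab => h b hη hab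

/-- `B(X) ⟺ B(X)` in every degree (Foster 2024 §1.1: "is said to hold for `X` if it holds in all
degrees"). [cite: Foster2024, §1.1 (arXiv:2303.14327 p. 2)] -/
theorem bStar_iff_forall_lefschetzStandardInDegree :
    StandardConjectureBStar n X η ↔ ∀ k, LefschetzStandardInDegree n X η k :=
  ⟨lefschetzStandardInDegree_of_bStar, bStar_of_forall_lefschetzStandardInDegree⟩

/-- In degree `k` the source degree is forced: `B(X)` in degree `k` is the algebraicity of the single map
`*_L : H^{2n-k}(X(ℂ); ℂ) → Hᵏ(X(ℂ); ℂ)` whenever `k ≤ 2n` (for `k > 2n` there is no complementary degree and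
the predicate is vacuous — as is `Hᵏ = 0`). [cite: Voisin2025, §3.2.2 (15)–(16) (p. 29)] -/
theorem lefschetzStandardInDegree_iff_of_le (k : ℕ) (hk : k ≤ 2 * n) :
    LefschetzStandardInDegree n X η k ↔
      ∀ (hη : IsPolarizationClass n X η),
        IsAlgebraicCorrespondence n n X X
          (lefschetzInvolution hη.hasHardLefschetz (show 2 * n - k + k = 2 * n by omega)) := by
  refine ⟨fun h hη => h hη _, fun h hη a hak => ?_⟩
  obtain rfl : a = 2 * n - k := by omega
  exact h hη

end Literature.AlgebraicGeometry.HodgeTheory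

end
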